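import Literature.Analysis.FluidPDE.GaussianVortexBiotSavartDivFreeForm
import Literature.Analysis.FluidPDE.GaussianVortexFormDomainTrunc
import HarnessLib

/-!
# Multiplication by the weight `ρ_λ` on the form domain `H¹(μ_λ)` and the flat `L²` identities

Analysis/FluidPDE file (all results proved, no definitions, no named facts), part of the
existence theory behind the named fact `GallayMaekawa2016_thm41` (Gallay–Maekawa 2016, Thm. 4.1,
Leray–Schauder part). In the ground-state picture `w = ρ_λ u`, `U = (u, G) ∈ H = H¹(μ_λ)`
(`GaussianVortexFormDomain`), the vorticity `w` itself corresponds to the pair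
`ρ_λ U := (ρ_λ u, ρ_λ G − u ρ_λ b_λ)`, `b_λ = ∇q_λ`; testing the resolvent equation against `ρ_λ U`
is how UNWEIGHTED (`L²(dx)`) energy estimates — in which the transport term `(v·∇)w` drops out —
are performed inside the weighted Hilbert framework. We prove:

* pointwise bounds `ρ_λ ≤ 1`, `ρ_λ‖b_λ‖ ≤ (1−λ)^{-1/2}`, `ρ_λ‖b_λ‖² ≤ 4/(1−λ)`;
* `weightMul_mem_gaussLamFormDomain` — **`ρ_λ U ∈ H`** for `U ∈ H`, with the a.e. formulae of
  its components;
* `integral_weight_mul_fst_mul_inner_drift_snd` — the integration-by-parts identity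
  `∫ ρ u ⟪b, G⟫ dμ_λ = ∫ ρ ‖b‖² u² dμ_λ − ½ ∫ ρ u² dμ_λ` on `H` (on graphs: `div(ρ² b) = ρ²(1 − 2‖b‖²)`);
* `inner_snd_weightMul_snd_eq` — consequently
  `⟪G, (ρU)₂⟫_{L²(μ)} = ‖∇w‖²_{L²(dx)} − ½‖w‖²_{L²(dx)}` with
  `‖w‖²_{L²(dx)} = ∫ ρ u² dμ_λ = ⟪u, (ρU)₁⟫` and `‖∇w‖²_{L²(dx)} = ∫ ρ‖G − u b‖² dμ_λ`, the flat form
  of `⟨−L_λ w, w⟩_{L²(dx)} = ‖∇w‖² − ½‖w‖²`.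

## References

* Th. Gallay, Y. Maekawa, *Existence and stability of viscous vortices*, arXiv:1610.08384, §4.1,
  (4.2)–(4.6), Thm. 4.1. [GallayMaekawa2016]
-/

open MeasureTheory Filter Set WithLp Metric
open scoped Real RealInnerProductSpace Topology InnerProductSpace ContDiff

noncomputable section

namespace Literature.Analysis.FluidPDE

open Literature.Analysis.UnboundedOperators

variable {lam : ℝ}

section Weight

variable (hlam : lam ∈ Set.Ico (0 : ℝ) 1)
include hlam

/-! ### Pointwise bounds for `ρ_λ`, `ρ_λ b_λ`, `ρ_λ ‖b_λ‖²` -/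

/-- `ρ_λ(x) ≤ exp(−(1−λ)|x|²/4)`. [folklore] -/
theorem expNegQuadLam_le_exp_neg (x : EuclideanSpace ℝ (Fin 2)) :
    Real.exp (-((1 + lam) / 4 * x 0 ^ 2 + (1 - lam) / 4 * x 1 ^ 2)) ≤
      Real.exp (-((1 - lam) / 4 * ‖x‖ ^ 2)) := by
  obtain ⟨hl0, hl1⟩ := hlam
  rw [Real.exp_le_exp, neg_le_neg_iff, EuclideanSpace.norm_sq_eq, Fin.sum_univ_two,
    Real.norm_eq_abs, Real.norm_eq_abs, sq_abs, sq_abs]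
  nlinarith [sq_nonneg (x 0), sq_nonneg (x 1)]

/-- `|x| exp(−(1−λ)|x|²/4) ≤ (1−λ)^{-1/2}` (AM–GM and `1 + t ≤ eᵗ`). [folklore] -/
theorem norm_mul_exp_neg_le (x : EuclideanSpace ℝ (Fin 2)) :
    ‖x‖ * Real.exp (-((1 - lam) / 4 * ‖x‖ ^ 2)) ≤ (Real.sqrt (1 - lam))⁻¹ := by
  obtain ⟨hl0, hl1⟩ := hlam
  have hq : 0 < 1 - lam := by linarith
  set s := Real.sqrt (1 - lam) with hs
  have hspos : 0 < s := Real.sqrt_pos.2 hq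
  have hs2 : s ^ 2 = 1 - lam := Real.sq_sqrt hq.le
  have h1 : s * ‖x‖ ≤ 1 + (1 - lam) / 4 * ‖x‖ ^ 2 := by
    nlinarith [sq_nonneg (s * ‖x‖ / 2 - 1), norm_nonneg x]
  have h2 : 1 + (1 - lam) / 4 * ‖x‖ ^ 2 ≤ Real.exp ((1 - lam) / 4 * ‖x‖ ^ 2) := by
    have := Real.add_one_le_exp ((1 - lam) / 4 * ‖x‖ ^ 2); linarith
  have hE := Real.exp_pos (-((1 - lam) / 4 * ‖x‖ ^ 2))
  have h3 : s * (‖x‖ * Real.exp (-((1 - lam) / 4 * ‖x‖ ^ 2))) ≤ 1 := by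
    have h := mul_le_mul_of_nonneg_right (h1.trans h2) hE.le
    rw [← Real.exp_add, add_neg_cancel, Real.exp_zero] at h
    calc s * (‖x‖ * Real.exp (-((1 - lam) / 4 * ‖x‖ ^ 2)))
        = s * ‖x‖ * Real.exp (-((1 - lam) / 4 * ‖x‖ ^ 2)) := by ring
      _ ≤ 1 := h
  rw [← one_div, le_div_iff₀' hspos]
  exact h3

/-- **`ρ_λ(x) ‖b_λ(x)‖ ≤ (1−λ)^{-1/2}`**, `b_λ(x) = ((1+λ)x₀/2, (1−λ)x₁/2)`. [folklore] -/
theorem expNegQuadLam_mul_norm_driftLam_le (x : EuclideanSpace ℝ (Fin 2)) :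
    Real.exp (-((1 + lam) / 4 * x 0 ^ 2 + (1 - lam) / 4 * x 1 ^ 2)) *
        ‖(toLp 2 ![(1 + lam) / 2 * x 0, (1 - lam) / 2 * x 1] : EuclideanSpace ℝ (Fin 2))‖ ≤
      (Real.sqrt (1 - lam))⁻¹ := by
  have hρ := Real.exp_pos (-((1 + lam) / 4 * x 0 ^ 2 + (1 - lam) / 4 * x 1 ^ 2))
  calc _ ≤ Real.exp (-((1 - lam) / 4 * ‖x‖ ^ 2)) * ‖x‖ :=
        mul_le_mul (expNegQuadLam_le_exp_neg hlam x) (norm_driftLam_le hlam x) (norm_nonneg _)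
          (Real.exp_pos _).le
    _ = ‖x‖ * Real.exp (-((1 - lam) / 4 * ‖x‖ ^ 2)) := mul_comm _ _
    _ ≤ _ := norm_mul_exp_neg_le hlam x

/-- **`ρ_λ(x) ‖b_λ(x)‖² ≤ 4/(1−λ)`** (`t e^{−ct} ≤ 1/c`). [folklore] -/
theorem expNegQuadLam_mul_norm_driftLam_sq_le (x : EuclideanSpace ℝ (Fin 2)) :
    Real.exp (-((1 + lam) / 4 * x 0 ^ 2 + (1 - lam) / 4 * x 1 ^ 2)) *
        ‖(toLp 2 ![(1 + lam) / 2 * x 0, (1 - lam) / 2 * x 1] : EuclideanSpace ℝ (Fin 2))‖ ^ 2 ≤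
      4 / (1 - lam) := by
  have hq : 0 < 1 - lam := by linarith [hlam.2]
  have hb := norm_driftLam_le hlam x
  have hρ1 := expNegQuadLam_le_exp_neg hlam x
  set t : ℝ := (1 - lam) / 4 * ‖x‖ ^ 2 with ht
  have ht0 : 0 ≤ t := by positivity
  -- `t e^{-t} ≤ 1`
  have hte : t * Real.exp (-t) ≤ 1 := by
    have h := Real.add_one_le_exp t
    have hE := Real.exp_pos (-t)
    have : t * Real.exp (-t) ≤ Real.exp t * Real.exp (-t) :=
      mul_le_mul_of_nonneg_right (by linarith) hE.le
    rwa [← Real.exp_add, add_neg_cancel, Real.exp_zero] at this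
  calc Real.exp (-((1 + lam) / 4 * x 0 ^ 2 + (1 - lam) / 4 * x 1 ^ 2)) *
        ‖(toLp 2 ![(1 + lam) / 2 * x 0, (1 - lam) / 2 * x 1] : EuclideanSpace ℝ (Fin 2))‖ ^ 2
      ≤ Real.exp (-t) * ‖x‖ ^ 2 := by
        refine mul_le_mul hρ1 (pow_le_pow_left₀ (norm_nonneg _) hb 2) (sq_nonneg _)
          (Real.exp_pos _).le
    _ = 4 / (1 - lam) * (t * Real.exp (-t)) := by rw [ht]; field_simp
    _ ≤ 4 / (1 - lam) * 1 := mul_le_mul_of_nonneg_left hte (by positivity)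
    _ = 4 / (1 - lam) := mul_one _

omit hlam in
/-- The drift field `b_λ` is continuous. [folklore] -/
theorem continuous_driftLam_field :
    Continuous fun x : EuclideanSpace ℝ (Fin 2) =>
      (toLp 2 ![(1 + lam) / 2 * x 0, (1 - lam) / 2 * x 1] : EuclideanSpace ℝ (Fin 2)) := by
  have h : (fun x : EuclideanSpace ℝ (Fin 2) =>
      (toLp 2 ![(1 + lam) / 2 * x 0, (1 - lam) / 2 * x 1] : EuclideanSpace ℝ (Fin 2))) =
      gradient (fun y : EuclideanSpace ℝ (Fin 2) => (1 + lam) / 4 * y 0 ^ 2 + (1 - lam) / 4 * y 1 ^ 2) := by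
    funext x; rw [gradient_quadraticLam]
  rw [h]
  exact continuous_gradient_fin_two ((contDiff_const.mul
    ((EuclideanSpace.proj (0 : Fin 2) : EuclideanSpace ℝ (Fin 2) →L[ℝ] ℝ).contDiff.pow 2)).add
    (contDiff_const.mul
    ((EuclideanSpace.proj (1 : Fin 2) : EuclideanSpace ℝ (Fin 2) →L[ℝ] ℝ).contDiff.pow 2)))

/-! ### `ρ_λ U ∈ H¹(μ_λ)` -/

/-- `ρ_λ u ∈ L²(μ_λ)` for `u ∈ L²(μ_λ)` (`ρ_λ ≤ 1`). [folklore] -/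
theorem memLp_weight_mul_fst (u : Lp ℝ 2 (gaussLamMeasure lam)) :
    MemLp (fun x : EuclideanSpace ℝ (Fin 2) =>
      Real.exp (-((1 + lam) / 4 * x 0 ^ 2 + (1 - lam) / 4 * x 1 ^ 2)) *
        (u : EuclideanSpace ℝ (Fin 2) → ℝ) x) 2 (gaussLamMeasure lam) := by
  refine MemLp.of_le_mul (c := 1) (Lp.memLp u) ((continuous_expNegQuadLam lam).aestronglyMeasurable.mul
    (Lp.aestronglyMeasurable u)) (Eventually.of_forall fun x => ?_)
  rw [norm_mul, one_mul, Real.norm_of_nonneg (Real.exp_pos _).le]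
  exact mul_le_of_le_one_left (norm_nonneg _) (expNegQuadLam_le_one hlam x)

/-- `ρ_λ G ∈ L²(μ_λ; ℝ²)` for `G ∈ L²(μ_λ; ℝ²)`. [folklore] -/
theorem memLp_weight_smul_snd (G : Lp (EuclideanSpace ℝ (Fin 2)) 2 (gaussLamMeasure lam)) :
    MemLp (fun x : EuclideanSpace ℝ (Fin 2) =>
      Real.exp (-((1 + lam) / 4 * x 0 ^ 2 + (1 - lam) / 4 * x 1 ^ 2)) •
        (G : EuclideanSpace ℝ (Fin 2) → EuclideanSpace ℝ (Fin 2)) x) 2 (gaussLamMeasure lam) := by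
  refine MemLp.of_le_mul (c := 1) (Lp.memLp G) ((continuous_expNegQuadLam lam).aestronglyMeasurable.smul
    (Lp.aestronglyMeasurable G)) (Eventually.of_forall fun x => ?_)
  rw [norm_smul, one_mul, Real.norm_of_nonneg (Real.exp_pos _).le]
  exact mul_le_of_le_one_left (norm_nonneg _) (expNegQuadLam_le_one hlam x)

/-- `u ρ_λ b_λ ∈ L²(μ_λ; ℝ²)` for `u ∈ L²(μ_λ)` (`ρ_λ‖b_λ‖ ≤ (1−λ)^{-1/2}`). [folklore] -/
theorem memLp_fst_smul_weight_drift (u : Lp ℝ 2 (gaussLamMeasure lam)) :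
    MemLp (fun x : EuclideanSpace ℝ (Fin 2) =>
      (u : EuclideanSpace ℝ (Fin 2) → ℝ) x •
        (Real.exp (-((1 + lam) / 4 * x 0 ^ 2 + (1 - lam) / 4 * x 1 ^ 2)) •
          (toLp 2 ![(1 + lam) / 2 * x 0, (1 - lam) / 2 * x 1] : EuclideanSpace ℝ (Fin 2))))
      2 (gaussLamMeasure lam) := by
  refine MemLp.of_le_mul (c := (Real.sqrt (1 - lam))⁻¹) (Lp.memLp u)
    ((Lp.aestronglyMeasurable u).smul (((continuous_expNegQuadLam lam).smul
      (continuous_driftLam_field)).aestronglyMeasurable)) (Eventually.of_forall fun x => ?_)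
  rw [norm_smul, norm_smul, Real.norm_of_nonneg (Real.exp_pos _).le, mul_comm]
  exact mul_le_mul_of_nonneg_right (expNegQuadLam_mul_norm_driftLam_le hlam x) (norm_nonneg _)

/-- The second component `ρ_λ G − u ρ_λ b_λ` of `ρ_λ U` lies in `L²(μ_λ; ℝ²)`. [folklore] -/
theorem memLp_weightMul_snd (u : Lp ℝ 2 (gaussLamMeasure lam))
    (G : Lp (EuclideanSpace ℝ (Fin 2)) 2 (gaussLamMeasure lam)) :
    MemLp (fun x : EuclideanSpace ℝ (Fin 2) =>
      Real.exp (-((1 + lam) / 4 * x 0 ^ 2 + (1 - lam) / 4 * x 1 ^ 2)) •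
          (G : EuclideanSpace ℝ (Fin 2) → EuclideanSpace ℝ (Fin 2)) x -
        (u : EuclideanSpace ℝ (Fin 2) → ℝ) x •
          (Real.exp (-((1 + lam) / 4 * x 0 ^ 2 + (1 - lam) / 4 * x 1 ^ 2)) •
            (toLp 2 ![(1 + lam) / 2 * x 0, (1 - lam) / 2 * x 1] : EuclideanSpace ℝ (Fin 2))))
      2 (gaussLamMeasure lam) :=
  (memLp_weight_smul_snd hlam G).sub (memLp_fst_smul_weight_drift hlam u)

omit hlam in
/-- For a test function `ψ`, `ρ_λ ψ` is a test function. [folklore] -/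
theorem weight_mul_mem_planarTestFunctions (ψ : planarTestFunctions) :
    (fun x : EuclideanSpace ℝ (Fin 2) =>
      Real.exp (-((1 + lam) / 4 * x 0 ^ 2 + (1 - lam) / 4 * x 1 ^ 2)) *
        (ψ : EuclideanSpace ℝ (Fin 2) → ℝ) x) ∈ planarTestFunctions :=
  ⟨(contDiff_exp_neg_quadraticLam lam).mul (planarTestFunctions.contDiff ψ),
    (planarTestFunctions.hasCompactSupport ψ).mul_left⟩

/-- **`ρ_λ U ∈ H¹(μ_λ)` for `U ∈ H¹(μ_λ)`**, `ρ_λ U = (ρ_λ u, ρ_λ G − u ρ_λ b_λ)`: graphs `ψₙ → U`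
give test functions `ρ_λψₙ` with `∇(ρ_λψₙ) = ρ_λ∇ψₙ − ψₙ ρ_λ b_λ` (`gradient_weight_mul`), and the
three multipliers `ρ_λ`, `ρ_λ`, `ρ_λ b_λ` are bounded. [folklore] -/
theorem weightMul_mem_gaussLamFormDomain
    {U : WithLp 2 (Lp ℝ 2 (gaussLamMeasure lam) × Lp (EuclideanSpace ℝ (Fin 2)) 2 (gaussLamMeasure lam))}
    (hU : U ∈ gaussLamFormDomain lam) :
    (toLp 2 ((memLp_weight_mul_fst hlam U.fst).toLp _, (memLp_weightMul_snd hlam U.fst U.snd).toLp _) :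
      WithLp 2 (Lp ℝ 2 (gaussLamMeasure lam) ×
        Lp (EuclideanSpace ℝ (Fin 2)) 2 (gaussLamMeasure lam))) ∈ gaussLamFormDomain lam := by
  set ρ : EuclideanSpace ℝ (Fin 2) → ℝ := fun x =>
    Real.exp (-((1 + lam) / 4 * x 0 ^ 2 + (1 - lam) / 4 * x 1 ^ 2)) with hρ
  set bv : EuclideanSpace ℝ (Fin 2) → EuclideanSpace ℝ (Fin 2) := fun x =>
    toLp 2 ![(1 + lam) / 2 * x 0, (1 - lam) / 2 * x 1] with hbv
  have hρb : ∀ x, ρ x * ‖bv x‖ ≤ (Real.sqrt (1 - lam))⁻¹ := expNegQuadLam_mul_norm_driftLam_le hlam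
  have hρ1 : ∀ x, ρ x ≤ 1 := expNegQuadLam_le_one hlam
  have hρ0 : ∀ x, 0 < ρ x := fun x => Real.exp_pos _
  obtain ⟨ψ, hlim⟩ := exists_seq_tendsto_gaussLamGraph hU
  have h1 : Tendsto (fun n => (gaussLamGraph lam (ψ n)).fst) atTop (𝓝 U.fst) :=
    ((WithLp.continuous_fst _ _ _).tendsto U).comp hlim
  have h2 : Tendsto (fun n => (gaussLamGraph lam (ψ n)).snd) atTop (𝓝 U.snd) :=
    ((WithLp.continuous_snd _ _ _).tendsto U).comp hlim
  set χ : ℕ → planarTestFunctions := fun n => ⟨_, weight_mul_mem_planarTestFunctions (ψ n)⟩ with hχ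
  have hχ_apply : ∀ n x, (χ n : EuclideanSpace ℝ (Fin 2) → ℝ) x = ρ x * (ψ n : EuclideanSpace ℝ (Fin 2) → ℝ) x :=
    fun n x => rfl
  have hχ_grad : ∀ n x, gradient (χ n : EuclideanSpace ℝ (Fin 2) → ℝ) x =
      ρ x • (gradient (ψ n : EuclideanSpace ℝ (Fin 2) → ℝ) x - (ψ n : EuclideanSpace ℝ (Fin 2) → ℝ) x • bv x) :=
    fun n x => gradient_weight_mul ((planarTestFunctions.contDiff (ψ n)).differentiable (by simp)) x
  refine mem_gaussLamFormDomain_of_tendsto (fun n => gaussLamGraph_mem lam (χ n)) ?_ ?_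
  · -- first components
    rw [tendsto_iff_norm_sub_tendsto_zero]
    have hb : ∀ n, ‖(gaussLamGraph lam (χ n)).fst - (memLp_weight_mul_fst hlam U.fst).toLp _‖ ≤
        1 * ‖(gaussLamGraph lam (ψ n)).fst - U.fst‖ := by
      intro n
      refine Lp.norm_le_mul_norm_of_ae_le_mul ?_
      filter_upwards [Lp.coeFn_sub (gaussLamGraph lam (χ n)).fst ((memLp_weight_mul_fst hlam U.fst).toLp _),
        Lp.coeFn_sub (gaussLamGraph lam (ψ n)).fst U.fst,
        MemLp.coeFn_toLp (memLp_planarTestFunction lam (χ n)),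
        MemLp.coeFn_toLp (memLp_planarTestFunction lam (ψ n)),
        MemLp.coeFn_toLp (memLp_weight_mul_fst hlam U.fst)] with x hx1 hx2 hx3 hx4 hx5
      rw [hx1, Pi.sub_apply, gaussLamGraph_fst, hx3, hx5, hχ_apply, ← mul_sub, norm_mul, one_mul,
        hx2, Pi.sub_apply, gaussLamGraph_fst, hx4, Real.norm_of_nonneg (hρ0 x).le]
      exact mul_le_of_le_one_left (norm_nonneg _) (hρ1 x)
    have h0 : Tendsto (fun n => 1 * ‖(gaussLamGraph lam (ψ n)).fst - U.fst‖) atTop (𝓝 0) := by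
      have := (tendsto_iff_norm_sub_tendsto_zero.1 h1).const_mul (1 : ℝ)
      simpa using this
    exact squeeze_zero (fun n => norm_nonneg _) hb h0
  · -- second components: `ρ∇ψₙ − ψₙ ρ b → ρ G − u ρ b`
    set P : ℕ → Lp (EuclideanSpace ℝ (Fin 2)) 2 (gaussLamMeasure lam) := fun n =>
      (memLp_weight_smul_snd hlam (gaussLamGraph lam (ψ n)).snd).toLp _ with hP
    set p : Lp (EuclideanSpace ℝ (Fin 2)) 2 (gaussLamMeasure lam) :=
      (memLp_weight_smul_snd hlam U.snd).toLp _ with hp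
    set Q : ℕ → Lp (EuclideanSpace ℝ (Fin 2)) 2 (gaussLamMeasure lam) := fun n =>
      (memLp_fst_smul_weight_drift hlam (gaussLamGraph lam (ψ n)).fst).toLp _ with hQ
    set q : Lp (EuclideanSpace ℝ (Fin 2)) 2 (gaussLamMeasure lam) :=
      (memLp_fst_smul_weight_drift hlam U.fst).toLp _ with hq
    -- (i) the graphs' second components are `P n − Q n`, the target is `p − q`
    have hB : ∀ n, (gaussLamGraph lam (χ n)).snd = P n - Q n := by
      intro n
      refine Lp.ext ?_
      filter_upwards [MemLp.coeFn_toLp (memLp_gradient_planarTestFunction lam (χ n)),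
        Lp.coeFn_sub (P n) (Q n),
        MemLp.coeFn_toLp (memLp_weight_smul_snd hlam (gaussLamGraph lam (ψ n)).snd),
        MemLp.coeFn_toLp (memLp_fst_smul_weight_drift hlam (gaussLamGraph lam (ψ n)).fst),
        MemLp.coeFn_toLp (memLp_gradient_planarTestFunction lam (ψ n)),
        MemLp.coeFn_toLp (memLp_planarTestFunction lam (ψ n))] with x hx1 hx2 hx3 hx4 hx5 hx6
      rw [gaussLamGraph_snd, hx1, hx2, Pi.sub_apply, hP, hQ]
      dsimp only
      rw [hx3, hx4, gaussLamGraph_snd, hx5, gaussLamGraph_fst, hx6, hχ_grad, smul_sub, smul_comm]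
    have hbT : (memLp_weightMul_snd hlam U.fst U.snd).toLp _ = p - q := MemLp.toLp_sub _ _
    -- (ii) the two pieces converge
    have hPp : Tendsto (fun n => P n - p) atTop (𝓝 0) := by
      rw [tendsto_zero_iff_norm_tendsto_zero]
      have hb : ∀ n, ‖P n - p‖ ≤ 1 * ‖(gaussLamGraph lam (ψ n)).snd - U.snd‖ := by
        intro n
        refine Lp.norm_le_mul_norm_of_ae_le_mul ?_
        filter_upwards [Lp.coeFn_sub (P n) p, Lp.coeFn_sub (gaussLamGraph lam (ψ n)).snd U.snd,
          MemLp.coeFn_toLp (memLp_weight_smul_snd hlam (gaussLamGraph lam (ψ n)).snd),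
          MemLp.coeFn_toLp (memLp_weight_smul_snd hlam U.snd)] with x hx1 hx2 hx3 hx4
        rw [hx1, Pi.sub_apply, hP, hp]
        dsimp only
        rw [hx3, hx4, ← smul_sub, norm_smul, hx2, Pi.sub_apply, one_mul,
          Real.norm_of_nonneg (hρ0 x).le]
        exact mul_le_of_le_one_left (norm_nonneg _) (hρ1 x)
      have h0 : Tendsto (fun n => 1 * ‖(gaussLamGraph lam (ψ n)).snd - U.snd‖) atTop (𝓝 0) := by
        have := (tendsto_iff_norm_sub_tendsto_zero.1 h2).const_mul (1 : ℝ)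
        simpa using this
      exact squeeze_zero (fun n => norm_nonneg _) hb h0
    have hQq : Tendsto (fun n => Q n - q) atTop (𝓝 0) := by
      rw [tendsto_zero_iff_norm_tendsto_zero]
      have hb : ∀ n, ‖Q n - q‖ ≤ (Real.sqrt (1 - lam))⁻¹ * ‖(gaussLamGraph lam (ψ n)).fst - U.fst‖ := by
        intro n
        refine Lp.norm_le_mul_norm_of_ae_le_mul ?_
        filter_upwards [Lp.coeFn_sub (Q n) q, Lp.coeFn_sub (gaussLamGraph lam (ψ n)).fst U.fst,
          MemLp.coeFn_toLp (memLp_fst_smul_weight_drift hlam (gaussLamGraph lam (ψ n)).fst),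
          MemLp.coeFn_toLp (memLp_fst_smul_weight_drift hlam U.fst)] with x hx1 hx2 hx3 hx4
        rw [hx1, Pi.sub_apply, hQ, hq]
        dsimp only
        rw [hx3, hx4, ← sub_smul, norm_smul, hx2, Pi.sub_apply, norm_smul,
          Real.norm_of_nonneg (hρ0 x).le, mul_comm]
        exact mul_le_mul_of_nonneg_right (hρb x) (norm_nonneg _)
      have h0 : Tendsto (fun n => (Real.sqrt (1 - lam))⁻¹ * ‖(gaussLamGraph lam (ψ n)).fst - U.fst‖)
          atTop (𝓝 0) := by
        have := (tendsto_iff_norm_sub_tendsto_zero.1 h1).const_mul ((Real.sqrt (1 - lam))⁻¹)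
        simpa using this
      exact squeeze_zero (fun n => norm_nonneg _) hb h0
    -- (iii) assemble
    rw [hbT]
    have h3 : Tendsto (fun n => (P n - p) - (Q n - q) + (p - q)) atTop
        (𝓝 ((0 : Lp (EuclideanSpace ℝ (Fin 2)) 2 (gaussLamMeasure lam)) - 0 + (p - q))) :=
      (hPp.sub hQq).add tendsto_const_nhds
    rw [sub_zero, zero_add] at h3
    refine h3.congr fun n => ?_
    rw [hB]; abel

/-- A.e. formula for the first component of `ρ_λ U`: `(ρ_λ U)₁ = ρ_λ u`. [folklore] -/
theorem weightMul_fst_ae (u : Lp ℝ 2 (gaussLamMeasure lam)) :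
    (((memLp_weight_mul_fst hlam u).toLp _ : Lp ℝ 2 (gaussLamMeasure lam)) : EuclideanSpace ℝ (Fin 2) → ℝ)
      =ᵐ[gaussLamMeasure lam] fun x => Real.exp (-((1 + lam) / 4 * x 0 ^ 2 + (1 - lam) / 4 * x 1 ^ 2)) *
        (u : EuclideanSpace ℝ (Fin 2) → ℝ) x :=
  MemLp.coeFn_toLp _

/-- A.e. formula for the second component of `ρ_λ U`: `(ρ_λ U)₂ = ρ_λ G − u ρ_λ b_λ`. [folklore] -/
theorem weightMul_snd_ae (u : Lp ℝ 2 (gaussLamMeasure lam))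
    (G : Lp (EuclideanSpace ℝ (Fin 2)) 2 (gaussLamMeasure lam)) :
    (((memLp_weightMul_snd hlam u G).toLp _ : Lp (EuclideanSpace ℝ (Fin 2)) 2 (gaussLamMeasure lam)) :
        EuclideanSpace ℝ (Fin 2) → EuclideanSpace ℝ (Fin 2))
      =ᵐ[gaussLamMeasure lam] fun x =>
        Real.exp (-((1 + lam) / 4 * x 0 ^ 2 + (1 - lam) / 4 * x 1 ^ 2)) •
          (G : EuclideanSpace ℝ (Fin 2) → EuclideanSpace ℝ (Fin 2)) x -
        (u : EuclideanSpace ℝ (Fin 2) → ℝ) x •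
          (Real.exp (-((1 + lam) / 4 * x 0 ^ 2 + (1 - lam) / 4 * x 1 ^ 2)) •
            (toLp 2 ![(1 + lam) / 2 * x 0, (1 - lam) / 2 * x 1] : EuclideanSpace ℝ (Fin 2))) :=
  MemLp.coeFn_toLp _

/-! ### The multiplier maps `u ↦ ρu`, `u ↦ u ρ b`, `u ↦ ρ‖b‖² u` are Lipschitz on `L²(μ_λ)` -/

/-- `ρ‖b‖² u ∈ L²(μ_λ)`. [folklore] -/
theorem memLp_weight_normSq_drift_mul (u : Lp ℝ 2 (gaussLamMeasure lam)) :
    MemLp (fun x : EuclideanSpace ℝ (Fin 2) =>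
      Real.exp (-((1 + lam) / 4 * x 0 ^ 2 + (1 - lam) / 4 * x 1 ^ 2)) *
        ‖(toLp 2 ![(1 + lam) / 2 * x 0, (1 - lam) / 2 * x 1] : EuclideanSpace ℝ (Fin 2))‖ ^ 2 *
        (u : EuclideanSpace ℝ (Fin 2) → ℝ) x) 2 (gaussLamMeasure lam) := by
  refine MemLp.of_le_mul (c := 4 / (1 - lam)) (Lp.memLp u)
    ((((continuous_expNegQuadLam lam).mul ((continuous_driftLam_field).norm.pow 2)).aestronglyMeasurable).mul
      (Lp.aestronglyMeasurable u)) (Eventually.of_forall fun x => ?_)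
  rw [norm_mul, Real.norm_of_nonneg (by positivity)]
  exact mul_le_mul_of_nonneg_right (expNegQuadLam_mul_norm_driftLam_sq_le hlam x) (norm_nonneg _)

/-- `u ↦ ρ_λ u` is `1`-Lipschitz on `L²(μ_λ)`. [folklore] -/
theorem norm_weight_mul_fst_sub_le (u u' : Lp ℝ 2 (gaussLamMeasure lam)) :
    ‖(memLp_weight_mul_fst hlam u).toLp _ - (memLp_weight_mul_fst hlam u').toLp _‖ ≤ 1 * ‖u - u'‖ := by
  refine Lp.norm_le_mul_norm_of_ae_le_mul ?_
  filter_upwards [Lp.coeFn_sub ((memLp_weight_mul_fst hlam u).toLp _) ((memLp_weight_mul_fst hlam u').toLp _),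
    Lp.coeFn_sub u u', MemLp.coeFn_toLp (memLp_weight_mul_fst hlam u),
    MemLp.coeFn_toLp (memLp_weight_mul_fst hlam u')] with x hx1 hx2 hx3 hx4
  rw [hx1, Pi.sub_apply, hx3, hx4, ← mul_sub, norm_mul, hx2, Pi.sub_apply, one_mul,
    Real.norm_of_nonneg (Real.exp_pos _).le]
  exact mul_le_of_le_one_left (norm_nonneg _) (expNegQuadLam_le_one hlam x)

/-- `u ↦ u ρ_λ b_λ` is `(1−λ)^{-1/2}`-Lipschitz on `L²(μ_λ)`. [folklore] -/
theorem norm_fst_smul_weight_drift_sub_le (u u' : Lp ℝ 2 (gaussLamMeasure lam)) :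
    ‖(memLp_fst_smul_weight_drift hlam u).toLp _ - (memLp_fst_smul_weight_drift hlam u').toLp _‖ ≤
      (Real.sqrt (1 - lam))⁻¹ * ‖u - u'‖ := by
  refine Lp.norm_le_mul_norm_of_ae_le_mul ?_
  filter_upwards [Lp.coeFn_sub ((memLp_fst_smul_weight_drift hlam u).toLp _)
      ((memLp_fst_smul_weight_drift hlam u').toLp _),
    Lp.coeFn_sub u u', MemLp.coeFn_toLp (memLp_fst_smul_weight_drift hlam u),
    MemLp.coeFn_toLp (memLp_fst_smul_weight_drift hlam u')] with x hx1 hx2 hx3 hx4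
  rw [hx1, Pi.sub_apply, hx3, hx4, ← sub_smul, norm_smul, hx2, Pi.sub_apply, norm_smul,
    Real.norm_of_nonneg (Real.exp_pos _).le, mul_comm]
  exact mul_le_mul_of_nonneg_right (expNegQuadLam_mul_norm_driftLam_le hlam x) (norm_nonneg _)

/-- `u ↦ ρ_λ ‖b_λ‖² u` is `4/(1−λ)`-Lipschitz on `L²(μ_λ)`. [folklore] -/
theorem norm_weight_normSq_drift_mul_sub_le (u u' : Lp ℝ 2 (gaussLamMeasure lam)) :
    ‖(memLp_weight_normSq_drift_mul hlam u).toLp _ - (memLp_weight_normSq_drift_mul hlam u').toLp _‖ ≤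
      4 / (1 - lam) * ‖u - u'‖ := by
  refine Lp.norm_le_mul_norm_of_ae_le_mul ?_
  filter_upwards [Lp.coeFn_sub ((memLp_weight_normSq_drift_mul hlam u).toLp _)
      ((memLp_weight_normSq_drift_mul hlam u').toLp _),
    Lp.coeFn_sub u u', MemLp.coeFn_toLp (memLp_weight_normSq_drift_mul hlam u),
    MemLp.coeFn_toLp (memLp_weight_normSq_drift_mul hlam u')] with x hx1 hx2 hx3 hx4
  rw [hx1, Pi.sub_apply, hx3, hx4, ← mul_sub, norm_mul, hx2, Pi.sub_apply,
    Real.norm_of_nonneg (by positivity)]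
  exact mul_le_mul_of_nonneg_right (expNegQuadLam_mul_norm_driftLam_sq_le hlam x) (norm_nonneg _)

/-- Continuity of `u ↦ ρ_λ u` on `L²(μ_λ)`. [folklore] -/
theorem continuous_weight_mul_fst :
    Continuous fun u : Lp ℝ 2 (gaussLamMeasure lam) => (memLp_weight_mul_fst hlam u).toLp _ := by
  refine (LipschitzWith.of_dist_le_mul (K := 1) fun u u' => ?_).continuous
  rw [dist_eq_norm, dist_eq_norm, NNReal.coe_one]
  exact norm_weight_mul_fst_sub_le hlam u u'

/-- Continuity of `u ↦ u ρ_λ b_λ` on `L²(μ_λ)`. [folklore] -/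
theorem continuous_fst_smul_weight_drift :
    Continuous fun u : Lp ℝ 2 (gaussLamMeasure lam) => (memLp_fst_smul_weight_drift hlam u).toLp _ := by
  refine (LipschitzWith.of_dist_le' (K := (Real.sqrt (1 - lam))⁻¹) fun u u' => ?_).continuous
  rw [dist_eq_norm, dist_eq_norm]
  exact norm_fst_smul_weight_drift_sub_le hlam u u'

/-- Continuity of `u ↦ ρ_λ ‖b_λ‖² u` on `L²(μ_λ)`. [folklore] -/
theorem continuous_weight_normSq_drift_mul :
    Continuous fun u : Lp ℝ 2 (gaussLamMeasure lam) => (memLp_weight_normSq_drift_mul hlam u).toLp _ := by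
  refine (LipschitzWith.of_dist_le' (K := 4 / (1 - lam)) fun u u' => ?_).continuous
  rw [dist_eq_norm, dist_eq_norm]
  exact norm_weight_normSq_drift_mul_sub_le hlam u u'

/-! ### Inner products with the multipliers as weighted integrals -/

/-- `⟪u', ρu⟫ = ∫ ρ u' u dμ_λ`. [folklore] -/
theorem inner_weight_mul_fst_eq (u u' : Lp ℝ 2 (gaussLamMeasure lam)) :
    ⟪u', (memLp_weight_mul_fst hlam u).toLp _⟫ =
      ∫ x, Real.exp (-((1 + lam) / 4 * x 0 ^ 2 + (1 - lam) / 4 * x 1 ^ 2)) *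
        (u' : EuclideanSpace ℝ (Fin 2) → ℝ) x * (u : EuclideanSpace ℝ (Fin 2) → ℝ) x ∂gaussLamMeasure lam := by
  rw [L2.inner_def]
  refine integral_congr_ae ?_
  filter_upwards [MemLp.coeFn_toLp (memLp_weight_mul_fst hlam u)] with x hx
  rw [hx]
  simp only [RCLike.inner_apply, conj_trivial]
  ring

/-- `⟪G, u ρ b⟫ = ∫ ρ u ⟪G, b⟫ dμ_λ`. [folklore] -/
theorem inner_fst_smul_weight_drift_eq (u : Lp ℝ 2 (gaussLamMeasure lam))
    (G : Lp (EuclideanSpace ℝ (Fin 2)) 2 (gaussLamMeasure lam)) :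
    ⟪G, (memLp_fst_smul_weight_drift hlam u).toLp _⟫ =
      ∫ x, Real.exp (-((1 + lam) / 4 * x 0 ^ 2 + (1 - lam) / 4 * x 1 ^ 2)) *
        (u : EuclideanSpace ℝ (Fin 2) → ℝ) x *
        ⟪(G : EuclideanSpace ℝ (Fin 2) → EuclideanSpace ℝ (Fin 2)) x,
          (toLp 2 ![(1 + lam) / 2 * x 0, (1 - lam) / 2 * x 1] : EuclideanSpace ℝ (Fin 2))⟫
        ∂gaussLamMeasure lam := by
  rw [L2.inner_def]
  refine integral_congr_ae ?_
  filter_upwards [MemLp.coeFn_toLp (memLp_fst_smul_weight_drift hlam u)] with x hx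
  rw [hx, inner_smul_right, inner_smul_right]
  ring

/-- `⟪u', ρ‖b‖²u⟫ = ∫ ρ‖b‖² u' u dμ_λ`. [folklore] -/
theorem inner_weight_normSq_drift_mul_eq (u u' : Lp ℝ 2 (gaussLamMeasure lam)) :
    ⟪u', (memLp_weight_normSq_drift_mul hlam u).toLp _⟫ =
      ∫ x, Real.exp (-((1 + lam) / 4 * x 0 ^ 2 + (1 - lam) / 4 * x 1 ^ 2)) *
        ‖(toLp 2 ![(1 + lam) / 2 * x 0, (1 - lam) / 2 * x 1] : EuclideanSpace ℝ (Fin 2))‖ ^ 2 *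
        (u' : EuclideanSpace ℝ (Fin 2) → ℝ) x * (u : EuclideanSpace ℝ (Fin 2) → ℝ) x ∂gaussLamMeasure lam := by
  rw [L2.inner_def]
  refine integral_congr_ae ?_
  filter_upwards [MemLp.coeFn_toLp (memLp_weight_normSq_drift_mul hlam u)] with x hx
  rw [hx]
  simp only [RCLike.inner_apply, conj_trivial]
  ring

/-! ### The integration-by-parts identity `∫ ρ u ⟪b, G⟫ = ∫ ρ‖b‖²u² − ½∫ ρ u²` -/

omit hlam in
/-- One coordinate: for a test function `ψ` and `∂ᵢρ = −(κxᵢ/2)ρ`,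
`∫ (κxᵢ/2) ψ ∂ᵢψ ρ² + (κ/4) ∫ ψ² ρ² = ∫ (κxᵢ/2)² ψ² ρ²` (integration by parts of
`f = (κ/4) xᵢ ψ²` against `g = ρ²`, `∂ᵢ(ρ²) = −κ xᵢ ρ²`). [folklore] -/
theorem integral_coord_drift_mul_mul_fderiv_weight_sq (ψ : planarTestFunctions) (i : Fin 2) {κ : ℝ}
    (hρi : ∀ x : EuclideanSpace ℝ (Fin 2), fderiv ℝ (fun y : EuclideanSpace ℝ (Fin 2) =>
      Real.exp (-((1 + lam) / 4 * y 0 ^ 2 + (1 - lam) / 4 * y 1 ^ 2))) x (EuclideanSpace.single i 1) =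
      -(κ * x i / 2) * Real.exp (-((1 + lam) / 4 * x 0 ^ 2 + (1 - lam) / 4 * x 1 ^ 2))) :
    (∫ x : EuclideanSpace ℝ (Fin 2), κ * x i / 2 * (ψ : EuclideanSpace ℝ (Fin 2) → ℝ) x *
        fderiv ℝ (ψ : EuclideanSpace ℝ (Fin 2) → ℝ) x (EuclideanSpace.single i 1) *
        Real.exp (-((1 + lam) / 4 * x 0 ^ 2 + (1 - lam) / 4 * x 1 ^ 2)) ^ 2) +
      κ / 4 * ∫ x : EuclideanSpace ℝ (Fin 2), (ψ : EuclideanSpace ℝ (Fin 2) → ℝ) x ^ 2 *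
        Real.exp (-((1 + lam) / 4 * x 0 ^ 2 + (1 - lam) / 4 * x 1 ^ 2)) ^ 2 =
      ∫ x : EuclideanSpace ℝ (Fin 2), (κ * x i / 2) ^ 2 * (ψ : EuclideanSpace ℝ (Fin 2) → ℝ) x ^ 2 *
        Real.exp (-((1 + lam) / 4 * x 0 ^ 2 + (1 - lam) / 4 * x 1 ^ 2)) ^ 2 := by
  set ρ : EuclideanSpace ℝ (Fin 2) → ℝ := fun y =>
    Real.exp (-((1 + lam) / 4 * y 0 ^ 2 + (1 - lam) / 4 * y 1 ^ 2)) with hρ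
  set φ : EuclideanSpace ℝ (Fin 2) → ℝ := (ψ : EuclideanSpace ℝ (Fin 2) → ℝ) with hφ
  have hφc : ContDiff ℝ ∞ φ := planarTestFunctions.contDiff ψ
  have hφs : HasCompactSupport φ := planarTestFunctions.hasCompactSupport ψ
  have hφd : Differentiable ℝ φ := hφc.differentiable (by simp)
  have hρc : Continuous ρ := continuous_expNegQuadLam lam
  have hρd : Differentiable ℝ ρ :=
    (contDiff_exp_neg_quadraticLam lam (n := 1)).differentiable one_ne_zero
  -- `f = (κ/4) xᵢ φ²`, `g = ρ²`
  set f : EuclideanSpace ℝ (Fin 2) → ℝ := fun x => κ / 4 * x i * φ x ^ 2 with hf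
  set g : EuclideanSpace ℝ (Fin 2) → ℝ := fun x => ρ x ^ 2 with hg
  have hcoord : ∀ x : EuclideanSpace ℝ (Fin 2), HasFDerivAt (fun y : EuclideanSpace ℝ (Fin 2) => y i)
      (EuclideanSpace.proj i : EuclideanSpace ℝ (Fin 2) →L[ℝ] ℝ) x := fun x =>
    (EuclideanSpace.proj i : EuclideanSpace ℝ (Fin 2) →L[ℝ] ℝ).hasFDerivAt
  have hfd : ∀ x, HasFDerivAt f ((κ / 4 * x i) • ((2 * φ x) • fderiv ℝ φ x) +
      (φ x ^ 2) • ((κ / 4) • (EuclideanSpace.proj i : EuclideanSpace ℝ (Fin 2) →L[ℝ] ℝ))) x := by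
    intro x
    have h1 : HasFDerivAt (fun y => φ y ^ 2) ((2 * φ x) • fderiv ℝ φ x) x := by
      have := ((hφd x).hasFDerivAt).pow 2
      simpa using this
    have h2 : HasFDerivAt (fun y : EuclideanSpace ℝ (Fin 2) => κ / 4 * y i)
        ((κ / 4) • (EuclideanSpace.proj i : EuclideanSpace ℝ (Fin 2) →L[ℝ] ℝ)) x :=
      (hcoord x).const_mul (κ / 4)
    have := h2.mul h1
    exact this
  have hf' : ∀ x, fderiv ℝ f x (EuclideanSpace.single i 1) =
      κ * x i / 2 * φ x * fderiv ℝ φ x (EuclideanSpace.single i 1) + κ / 4 * φ x ^ 2 := by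
    intro x
    rw [(hfd x).fderiv]
    simp
    ring
  have hgd : ∀ x, HasFDerivAt g ((2 * ρ x) • fderiv ℝ ρ x) x := by
    intro x
    have := ((hρd x).hasFDerivAt).pow 2
    simpa using this
  have hg' : ∀ x, fderiv ℝ g x (EuclideanSpace.single i 1) = -(κ * x i) * ρ x ^ 2 := by
    intro x
    rw [(hgd x).fderiv]
    show (2 * ρ x) • (fderiv ℝ (fun y : EuclideanSpace ℝ (Fin 2) =>
      Real.exp (-((1 + lam) / 4 * y 0 ^ 2 + (1 - lam) / 4 * y 1 ^ 2))) x (EuclideanSpace.single i 1)) =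
      -(κ * x i) * ρ x ^ 2
    rw [hρi, smul_eq_mul]
    ring
  -- continuity and compact support of the integrands
  have hxi : Continuous fun x : EuclideanSpace ℝ (Fin 2) => x i := PiLp.continuous_apply 2 _ i
  have hfc : Continuous f := (continuous_const.mul hxi).mul (hφc.continuous.pow 2)
  have hfs : HasCompactSupport f := hφs.mono (by
    intro x hx
    simp only [Function.mem_support, ne_eq, hf] at hx ⊢
    contrapose! hx
    simp [hx])
  have hgc : Continuous g := hρc.pow 2
  have hφ1c : Continuous fun x => fderiv ℝ φ x (EuclideanSpace.single i 1) :=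
    (hφc.continuous_fderiv (by simp)).clm_apply continuous_const
  have hDc : Continuous fun x : EuclideanSpace ℝ (Fin 2) =>
      κ * x i / 2 * φ x * fderiv ℝ φ x (EuclideanSpace.single i 1) + κ / 4 * φ x ^ 2 :=
    ((((continuous_const.mul hxi).div_const _).mul hφc.continuous).mul hφ1c).add
      (continuous_const.mul (hφc.continuous.pow 2))
  have hDs : HasCompactSupport fun x : EuclideanSpace ℝ (Fin 2) =>
      κ * x i / 2 * φ x * fderiv ℝ φ x (EuclideanSpace.single i 1) + κ / 4 * φ x ^ 2 :=
    hφs.mono (by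
      intro x hx
      simp only [Function.mem_support, ne_eq] at hx ⊢
      contrapose! hx
      simp [hx])
  have hf'fun : (fun x => fderiv ℝ f x (EuclideanSpace.single i 1) * g x) =
      fun x => (κ * x i / 2 * φ x * fderiv ℝ φ x (EuclideanSpace.single i 1) + κ / 4 * φ x ^ 2) * ρ x ^ 2 := by
    funext x; rw [hf']
  have i1 : Integrable fun x => fderiv ℝ f x (EuclideanSpace.single i 1) * g x := by
    rw [hf'fun]
    exact (hDc.mul hgc).integrable_of_hasCompactSupport hDs.mul_right
  have hg'c : Continuous fun x => fderiv ℝ g x (EuclideanSpace.single i 1) := by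
    have : (fun x => fderiv ℝ g x (EuclideanSpace.single i 1)) = fun x => -(κ * x i) * ρ x ^ 2 := funext hg'
    rw [this]
    exact (continuous_const.mul hxi).neg.mul hgc
  have i2 : Integrable fun x => f x * fderiv ℝ g x (EuclideanSpace.single i 1) :=
    (hfc.mul hg'c).integrable_of_hasCompactSupport hfs.mul_right
  have i3 : Integrable fun x => f x * g x :=
    (hfc.mul hgc).integrable_of_hasCompactSupport hfs.mul_right
  have hibp := integral_mul_fderiv_eq_neg_fderiv_mul_of_integrable i1 i2 i3
    (fun x _ => (hfd x).differentiableAt) (fun x _ => (hgd x).differentiableAt)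
  -- assemble
  have iA : Integrable fun x : EuclideanSpace ℝ (Fin 2) =>
      κ * x i / 2 * φ x * fderiv ℝ φ x (EuclideanSpace.single i 1) * ρ x ^ 2 :=
    (((((continuous_const.mul hxi).div_const _).mul hφc.continuous).mul hφ1c).mul
      hgc).integrable_of_hasCompactSupport (hφs.mono (by
        intro x hx
        simp only [Function.mem_support, ne_eq] at hx ⊢
        contrapose! hx
        simp [hx]))
  have iB : Integrable fun x : EuclideanSpace ℝ (Fin 2) => φ x ^ 2 * ρ x ^ 2 :=
    ((hφc.continuous.pow 2).mul hgc).integrable_of_hasCompactSupport (hφs.mono (by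
        intro x hx
        simp only [Function.mem_support, ne_eq] at hx ⊢
        contrapose! hx
        simp [hx]))
  have lhs : (∫ x : EuclideanSpace ℝ (Fin 2), κ * x i / 2 * φ x *
        fderiv ℝ φ x (EuclideanSpace.single i 1) * ρ x ^ 2) +
      κ / 4 * ∫ x : EuclideanSpace ℝ (Fin 2), φ x ^ 2 * ρ x ^ 2 =
      ∫ x, fderiv ℝ f x (EuclideanSpace.single i 1) * g x := by
    rw [hf'fun, ← integral_const_mul, ← integral_add iA (iB.const_mul _)]
    refine integral_congr_ae (Eventually.of_forall fun x => ?_)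
    ring
  rw [lhs]
  have h2 : ∫ x, fderiv ℝ f x (EuclideanSpace.single i 1) * g x =
      -∫ x, f x * fderiv ℝ g x (EuclideanSpace.single i 1) := by
    rw [hibp, neg_neg]
  rw [h2, ← integral_neg]
  refine integral_congr_ae (Eventually.of_forall fun x => ?_)
  dsimp only
  rw [hg' x]
  simp only [hf]
  ring

omit hlam in
/-- **The identity on graphs**: for a test function `ψ`,
`∫ ρ² ψ ⟪b, ∇ψ⟫ dx = ∫ ρ² ‖b‖² ψ² dx − ½ ∫ ρ² ψ² dx` (sum of the two coordinate identities,
`(κ₀ + κ₁)/4 = ½`). [folklore] -/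
theorem integral_weight_sq_mul_mul_inner_drift_gradient (ψ : planarTestFunctions) :
    ∫ x : EuclideanSpace ℝ (Fin 2), Real.exp (-((1 + lam) / 4 * x 0 ^ 2 + (1 - lam) / 4 * x 1 ^ 2)) ^ 2 *
        (ψ : EuclideanSpace ℝ (Fin 2) → ℝ) x *
        ⟪gradient (ψ : EuclideanSpace ℝ (Fin 2) → ℝ) x,
          (toLp 2 ![(1 + lam) / 2 * x 0, (1 - lam) / 2 * x 1] : EuclideanSpace ℝ (Fin 2))⟫ =
      (∫ x : EuclideanSpace ℝ (Fin 2), Real.exp (-((1 + lam) / 4 * x 0 ^ 2 + (1 - lam) / 4 * x 1 ^ 2)) ^ 2 *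
        ‖(toLp 2 ![(1 + lam) / 2 * x 0, (1 - lam) / 2 * x 1] : EuclideanSpace ℝ (Fin 2))‖ ^ 2 *
        (ψ : EuclideanSpace ℝ (Fin 2) → ℝ) x ^ 2) -
      1 / 2 * ∫ x : EuclideanSpace ℝ (Fin 2), Real.exp (-((1 + lam) / 4 * x 0 ^ 2 + (1 - lam) / 4 * x 1 ^ 2)) ^ 2 *
        (ψ : EuclideanSpace ℝ (Fin 2) → ℝ) x ^ 2 := by
  have h0 := integral_coord_drift_mul_mul_fderiv_weight_sq (lam := lam) ψ 0
    (fderiv_exp_neg_quadraticLam_zero lam)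
  have h1 := integral_coord_drift_mul_mul_fderiv_weight_sq (lam := lam) ψ 1
    (fderiv_exp_neg_quadraticLam_one lam)
  set ρ : EuclideanSpace ℝ (Fin 2) → ℝ := fun y =>
    Real.exp (-((1 + lam) / 4 * y 0 ^ 2 + (1 - lam) / 4 * y 1 ^ 2)) with hρ
  set φ : EuclideanSpace ℝ (Fin 2) → ℝ := (ψ : EuclideanSpace ℝ (Fin 2) → ℝ) with hφ
  have hφc : ContDiff ℝ ∞ φ := planarTestFunctions.contDiff ψ
  have hφs : HasCompactSupport φ := planarTestFunctions.hasCompactSupport ψ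
  have hρc : Continuous ρ := continuous_expNegQuadLam lam
  have hgc : Continuous fun x => ρ x ^ 2 := hρc.pow 2
  have hφ1c : ∀ j : Fin 2, Continuous fun x => fderiv ℝ φ x (EuclideanSpace.single j 1) := fun j =>
    (hφc.continuous_fderiv (by simp)).clm_apply continuous_const
  -- pointwise expansions of `⟪b, ∇ψ⟫` and `‖b‖²`
  have hinner : ∀ x : EuclideanSpace ℝ (Fin 2),
      ⟪gradient φ x, (toLp 2 ![(1 + lam) / 2 * x 0, (1 - lam) / 2 * x 1] : EuclideanSpace ℝ (Fin 2))⟫ =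
        (1 + lam) * x 0 / 2 * fderiv ℝ φ x (EuclideanSpace.single 0 1) +
          (1 - lam) * x 1 / 2 * fderiv ℝ φ x (EuclideanSpace.single 1 1) := by
    intro x
    rw [PiLp.inner_apply]
    simp only [Fin.sum_univ_two, gradient_apply_eq_fderiv_fin_two,
      Matrix.cons_val_zero, Matrix.cons_val_one, RCLike.inner_apply, conj_trivial]
    ring
  have hnormsq : ∀ x : EuclideanSpace ℝ (Fin 2),
      ‖(toLp 2 ![(1 + lam) / 2 * x 0, (1 - lam) / 2 * x 1] : EuclideanSpace ℝ (Fin 2))‖ ^ 2 =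
        ((1 + lam) * x 0 / 2) ^ 2 + ((1 - lam) * x 1 / 2) ^ 2 := by
    intro x
    rw [EuclideanSpace.norm_sq_eq, Fin.sum_univ_two]
    simp only [Matrix.cons_val_zero, Matrix.cons_val_one, Real.norm_eq_abs, sq_abs]
    ring
  -- integrability
  have iA : ∀ (j : Fin 2) (κ : ℝ), Integrable fun x : EuclideanSpace ℝ (Fin 2) =>
      κ * x j / 2 * φ x * fderiv ℝ φ x (EuclideanSpace.single j 1) * ρ x ^ 2 := fun j κ =>
    (((((continuous_const.mul (PiLp.continuous_apply 2 _ j)).div_const _).mul hφc.continuous).mul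
      (hφ1c j)).mul hgc).integrable_of_hasCompactSupport (hφs.mono (by
        intro x hx
        simp only [Function.mem_support, ne_eq] at hx ⊢
        contrapose! hx
        simp [hx]))
  have iC : ∀ (j : Fin 2) (κ : ℝ), Integrable fun x : EuclideanSpace ℝ (Fin 2) =>
      (κ * x j / 2) ^ 2 * φ x ^ 2 * ρ x ^ 2 := fun j κ =>
    (((((continuous_const.mul (PiLp.continuous_apply 2 _ j)).div_const _).pow 2).mul
      (hφc.continuous.pow 2)).mul hgc).integrable_of_hasCompactSupport (hφs.mono (by
        intro x hx
        simp only [Function.mem_support, ne_eq] at hx ⊢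
        contrapose! hx
        simp [hx]))
  have eL : ∫ x : EuclideanSpace ℝ (Fin 2), ρ x ^ 2 * φ x *
        ⟪gradient φ x, (toLp 2 ![(1 + lam) / 2 * x 0, (1 - lam) / 2 * x 1] : EuclideanSpace ℝ (Fin 2))⟫ =
      (∫ x : EuclideanSpace ℝ (Fin 2), (1 + lam) * x 0 / 2 * φ x * fderiv ℝ φ x (EuclideanSpace.single 0 1) * ρ x ^ 2) +
        ∫ x : EuclideanSpace ℝ (Fin 2), (1 - lam) * x 1 / 2 * φ x * fderiv ℝ φ x (EuclideanSpace.single 1 1) * ρ x ^ 2 := by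
    rw [← integral_add (iA 0 _) (iA 1 _)]
    refine integral_congr_ae (Eventually.of_forall fun x => ?_)
    dsimp only
    rw [hinner x]
    ring
  have eC : ∫ x : EuclideanSpace ℝ (Fin 2), ρ x ^ 2 *
        ‖(toLp 2 ![(1 + lam) / 2 * x 0, (1 - lam) / 2 * x 1] : EuclideanSpace ℝ (Fin 2))‖ ^ 2 * φ x ^ 2 =
      (∫ x : EuclideanSpace ℝ (Fin 2), ((1 + lam) * x 0 / 2) ^ 2 * φ x ^ 2 * ρ x ^ 2) +
        ∫ x : EuclideanSpace ℝ (Fin 2), ((1 - lam) * x 1 / 2) ^ 2 * φ x ^ 2 * ρ x ^ 2 := by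
    rw [← integral_add (iC 0 _) (iC 1 _)]
    refine integral_congr_ae (Eventually.of_forall fun x => ?_)
    dsimp only
    rw [hnormsq x]
    ring
  have eB : ∫ x : EuclideanSpace ℝ (Fin 2), ρ x ^ 2 * φ x ^ 2 =
      ∫ x : EuclideanSpace ℝ (Fin 2), φ x ^ 2 * ρ x ^ 2 :=
    integral_congr_ae (Eventually.of_forall fun x => by ring)
  rw [eL, eC, eB, ← h0, ← h1]
  ring

/-- **The identity on `H¹(μ_λ)`**: for `U = (u, G) ∈ H`,
`∫ ρ u ⟪b, G⟫ dμ_λ = ∫ ρ ‖b‖² u² dμ_λ − ½ ∫ ρ u² dμ_λ` (both sides are continuous on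
`L²(μ_λ) × L²(μ_λ; ℝ²)` and agree on graphs by `integral_weight_sq_mul_mul_inner_drift_gradient`).
Stated with the three `L²(μ_λ)` inner products `⟪G, uρb⟫`, `⟪u, ρ‖b‖²u⟫`, `⟪u, ρu⟫`. [folklore] -/
theorem inner_snd_fst_smul_weight_drift_eq
    {U : WithLp 2 (Lp ℝ 2 (gaussLamMeasure lam) × Lp (EuclideanSpace ℝ (Fin 2)) 2 (gaussLamMeasure lam))}
    (hU : U ∈ gaussLamFormDomain lam) :
    ⟪U.snd, (memLp_fst_smul_weight_drift hlam U.fst).toLp _⟫ =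
      ⟪U.fst, (memLp_weight_normSq_drift_mul hlam U.fst).toLp _⟫ -
        1 / 2 * ⟪U.fst, (memLp_weight_mul_fst hlam U.fst).toLp _⟫ := by
  refine gaussLamFormDomain_induction lam (P := fun V => ⟪V.snd, (memLp_fst_smul_weight_drift hlam V.fst).toLp _⟫ =
      ⟪V.fst, (memLp_weight_normSq_drift_mul hlam V.fst).toLp _⟫ -
        1 / 2 * ⟪V.fst, (memLp_weight_mul_fst hlam V.fst).toLp _⟫) ?_ ?_ hU
  · refine isClosed_eq ?_ ?_
    · exact (WithLp.continuous_snd _ _ _).inner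
        ((continuous_fst_smul_weight_drift hlam).comp (WithLp.continuous_fst _ _ _))
    · exact ((WithLp.continuous_fst _ _ _).inner
        ((continuous_weight_normSq_drift_mul hlam).comp (WithLp.continuous_fst _ _ _))).sub
        (continuous_const.mul ((WithLp.continuous_fst _ _ _).inner
          ((continuous_weight_mul_fst hlam).comp (WithLp.continuous_fst _ _ _))))
  · intro ψ
    have hI := integral_weight_sq_mul_mul_inner_drift_gradient (lam := lam) ψ
    rw [inner_fst_smul_weight_drift_eq hlam, inner_weight_normSq_drift_mul_eq hlam, inner_weight_mul_fst_eq hlam,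
      integral_gaussLamMeasure, integral_gaussLamMeasure, integral_gaussLamMeasure]
    have e1 : ∫ x : EuclideanSpace ℝ (Fin 2), Real.exp (-((1 + lam) / 4 * x 0 ^ 2 + (1 - lam) / 4 * x 1 ^ 2)) *
          ((gaussLamGraph lam ψ).fst : EuclideanSpace ℝ (Fin 2) → ℝ) x *
          ⟪((gaussLamGraph lam ψ).snd : EuclideanSpace ℝ (Fin 2) → EuclideanSpace ℝ (Fin 2)) x,
            (toLp 2 ![(1 + lam) / 2 * x 0, (1 - lam) / 2 * x 1] : EuclideanSpace ℝ (Fin 2))⟫ *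
          Real.exp (-((1 + lam) / 4 * x 0 ^ 2 + (1 - lam) / 4 * x 1 ^ 2)) =
        ∫ x : EuclideanSpace ℝ (Fin 2), Real.exp (-((1 + lam) / 4 * x 0 ^ 2 + (1 - lam) / 4 * x 1 ^ 2)) ^ 2 *
          (ψ : EuclideanSpace ℝ (Fin 2) → ℝ) x *
          ⟪gradient (ψ : EuclideanSpace ℝ (Fin 2) → ℝ) x,
            (toLp 2 ![(1 + lam) / 2 * x 0, (1 - lam) / 2 * x 1] : EuclideanSpace ℝ (Fin 2))⟫ := by
      refine integral_congr_ae ((ae_gaussLamMeasure_iff lam).1 ?_)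
      filter_upwards [MemLp.coeFn_toLp (memLp_planarTestFunction lam ψ),
        MemLp.coeFn_toLp (memLp_gradient_planarTestFunction lam ψ)] with x hx1 hx2
      rw [gaussLamGraph_fst, gaussLamGraph_snd, hx1, hx2]
      ring
    have e2 : ∫ x : EuclideanSpace ℝ (Fin 2), Real.exp (-((1 + lam) / 4 * x 0 ^ 2 + (1 - lam) / 4 * x 1 ^ 2)) *
          ‖(toLp 2 ![(1 + lam) / 2 * x 0, (1 - lam) / 2 * x 1] : EuclideanSpace ℝ (Fin 2))‖ ^ 2 *
          ((gaussLamGraph lam ψ).fst : EuclideanSpace ℝ (Fin 2) → ℝ) x *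
          ((gaussLamGraph lam ψ).fst : EuclideanSpace ℝ (Fin 2) → ℝ) x *
          Real.exp (-((1 + lam) / 4 * x 0 ^ 2 + (1 - lam) / 4 * x 1 ^ 2)) =
        ∫ x : EuclideanSpace ℝ (Fin 2), Real.exp (-((1 + lam) / 4 * x 0 ^ 2 + (1 - lam) / 4 * x 1 ^ 2)) ^ 2 *
          ‖(toLp 2 ![(1 + lam) / 2 * x 0, (1 - lam) / 2 * x 1] : EuclideanSpace ℝ (Fin 2))‖ ^ 2 *
          (ψ : EuclideanSpace ℝ (Fin 2) → ℝ) x ^ 2 := by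
      refine integral_congr_ae ((ae_gaussLamMeasure_iff lam).1 ?_)
      filter_upwards [MemLp.coeFn_toLp (memLp_planarTestFunction lam ψ)] with x hx1
      rw [gaussLamGraph_fst, hx1]
      ring
    have e3 : ∫ x : EuclideanSpace ℝ (Fin 2), Real.exp (-((1 + lam) / 4 * x 0 ^ 2 + (1 - lam) / 4 * x 1 ^ 2)) *
          ((gaussLamGraph lam ψ).fst : EuclideanSpace ℝ (Fin 2) → ℝ) x *
          ((gaussLamGraph lam ψ).fst : EuclideanSpace ℝ (Fin 2) → ℝ) x *
          Real.exp (-((1 + lam) / 4 * x 0 ^ 2 + (1 - lam) / 4 * x 1 ^ 2)) =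
        ∫ x : EuclideanSpace ℝ (Fin 2), Real.exp (-((1 + lam) / 4 * x 0 ^ 2 + (1 - lam) / 4 * x 1 ^ 2)) ^ 2 *
          (ψ : EuclideanSpace ℝ (Fin 2) → ℝ) x ^ 2 := by
      refine integral_congr_ae ((ae_gaussLamMeasure_iff lam).1 ?_)
      filter_upwards [MemLp.coeFn_toLp (memLp_planarTestFunction lam ψ)] with x hx1
      rw [gaussLamGraph_fst, hx1]
      ring
    rw [e1, e2, e3, hI]

/-! ### The flat energy identity `⟪G, (ρU)₂⟫ = ‖∇w‖² − ½‖w‖²` -/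

/-- The flat gradient energy `∫ ρ ‖G − u b‖² dμ_λ` is finite for `U ∈ L² × L²` and expands as
`∫ ρ‖G‖² − 2 ∫ ρ u ⟪b, G⟫ + ∫ ρ ‖b‖² u²`. [folklore] -/
theorem integral_weight_mul_norm_sub_smul_sq_eq (u : Lp ℝ 2 (gaussLamMeasure lam))
    (G : Lp (EuclideanSpace ℝ (Fin 2)) 2 (gaussLamMeasure lam)) :
    Integrable (fun x : EuclideanSpace ℝ (Fin 2) =>
        Real.exp (-((1 + lam) / 4 * x 0 ^ 2 + (1 - lam) / 4 * x 1 ^ 2)) *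
          ‖(G : EuclideanSpace ℝ (Fin 2) → EuclideanSpace ℝ (Fin 2)) x -
            (u : EuclideanSpace ℝ (Fin 2) → ℝ) x •
              (toLp 2 ![(1 + lam) / 2 * x 0, (1 - lam) / 2 * x 1] : EuclideanSpace ℝ (Fin 2))‖ ^ 2)
        (gaussLamMeasure lam) ∧
      ∫ x, Real.exp (-((1 + lam) / 4 * x 0 ^ 2 + (1 - lam) / 4 * x 1 ^ 2)) *
          ‖(G : EuclideanSpace ℝ (Fin 2) → EuclideanSpace ℝ (Fin 2)) x -
            (u : EuclideanSpace ℝ (Fin 2) → ℝ) x •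
              (toLp 2 ![(1 + lam) / 2 * x 0, (1 - lam) / 2 * x 1] : EuclideanSpace ℝ (Fin 2))‖ ^ 2
          ∂gaussLamMeasure lam =
        ⟪G, (memLp_weight_smul_snd hlam G).toLp _⟫ - 2 * ⟪G, (memLp_fst_smul_weight_drift hlam u).toLp _⟫ +
          ⟪u, (memLp_weight_normSq_drift_mul hlam u).toLp _⟫ := by
  set ρ : EuclideanSpace ℝ (Fin 2) → ℝ := fun x =>
    Real.exp (-((1 + lam) / 4 * x 0 ^ 2 + (1 - lam) / 4 * x 1 ^ 2)) with hρ
  set bv : EuclideanSpace ℝ (Fin 2) → EuclideanSpace ℝ (Fin 2) := fun x =>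
    toLp 2 ![(1 + lam) / 2 * x 0, (1 - lam) / 2 * x 1] with hbv
  have hρ0 : ∀ x, 0 < ρ x := fun x => Real.exp_pos _
  -- the three integrable pieces
  have hGG : Integrable (fun x => ρ x * ‖(G : EuclideanSpace ℝ (Fin 2) → EuclideanSpace ℝ (Fin 2)) x‖ ^ 2)
      (gaussLamMeasure lam) := by
    have h := L2.integrable_inner (𝕜 := ℝ) G ((memLp_weight_smul_snd hlam G).toLp _)
    refine h.congr ?_
    filter_upwards [MemLp.coeFn_toLp (memLp_weight_smul_snd hlam G)] with x hx
    rw [hx, inner_smul_right, real_inner_self_eq_norm_sq]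
  have hGb : Integrable (fun x => ρ x * (u : EuclideanSpace ℝ (Fin 2) → ℝ) x *
      ⟪(G : EuclideanSpace ℝ (Fin 2) → EuclideanSpace ℝ (Fin 2)) x, bv x⟫) (gaussLamMeasure lam) := by
    have h := L2.integrable_inner (𝕜 := ℝ) G ((memLp_fst_smul_weight_drift hlam u).toLp _)
    refine h.congr ?_
    filter_upwards [MemLp.coeFn_toLp (memLp_fst_smul_weight_drift hlam u)] with x hx
    rw [hx, inner_smul_right, inner_smul_right]
    simp only [hρ, hbv]
    ring
  have huu : Integrable (fun x => ρ x * ‖bv x‖ ^ 2 * (u : EuclideanSpace ℝ (Fin 2) → ℝ) x ^ 2)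
      (gaussLamMeasure lam) := by
    have h := L2.integrable_inner (𝕜 := ℝ) u ((memLp_weight_normSq_drift_mul hlam u).toLp _)
    refine h.congr ?_
    filter_upwards [MemLp.coeFn_toLp (memLp_weight_normSq_drift_mul hlam u)] with x hx
    rw [hx]
    simp only [RCLike.inner_apply, conj_trivial, hρ, hbv]
    ring
  have hexp : ∀ x, ρ x * ‖(G : EuclideanSpace ℝ (Fin 2) → EuclideanSpace ℝ (Fin 2)) x -
      (u : EuclideanSpace ℝ (Fin 2) → ℝ) x • bv x‖ ^ 2 =
      ρ x * ‖(G : EuclideanSpace ℝ (Fin 2) → EuclideanSpace ℝ (Fin 2)) x‖ ^ 2 -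
        2 * (ρ x * (u : EuclideanSpace ℝ (Fin 2) → ℝ) x *
          ⟪(G : EuclideanSpace ℝ (Fin 2) → EuclideanSpace ℝ (Fin 2)) x, bv x⟫) +
        ρ x * ‖bv x‖ ^ 2 * (u : EuclideanSpace ℝ (Fin 2) → ℝ) x ^ 2 := by
    intro x
    rw [norm_sub_sq_real, inner_smul_right, norm_smul, mul_pow, Real.norm_eq_abs, sq_abs]
    ring
  have hint : Integrable (fun x => ρ x * ‖(G : EuclideanSpace ℝ (Fin 2) → EuclideanSpace ℝ (Fin 2)) x -
      (u : EuclideanSpace ℝ (Fin 2) → ℝ) x • bv x‖ ^ 2) (gaussLamMeasure lam) := by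
    have := (hGG.sub (hGb.const_mul 2)).add huu
    refine this.congr (Eventually.of_forall fun x => ?_)
    simp only [Pi.add_apply, Pi.sub_apply]
    rw [hexp]
  refine ⟨hint, ?_⟩
  rw [inner_fst_smul_weight_drift_eq hlam, inner_weight_normSq_drift_mul_eq hlam]
  have e1 : ⟪G, (memLp_weight_smul_snd hlam G).toLp _⟫ =
      ∫ x, ρ x * ‖(G : EuclideanSpace ℝ (Fin 2) → EuclideanSpace ℝ (Fin 2)) x‖ ^ 2 ∂gaussLamMeasure lam := by
    rw [L2.inner_def]
    refine integral_congr_ae ?_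
    filter_upwards [MemLp.coeFn_toLp (memLp_weight_smul_snd hlam G)] with x hx
    rw [hx, inner_smul_right, real_inner_self_eq_norm_sq]
  have e4 : ∫ x, ρ x * ‖bv x‖ ^ 2 * (u : EuclideanSpace ℝ (Fin 2) → ℝ) x *
      (u : EuclideanSpace ℝ (Fin 2) → ℝ) x ∂gaussLamMeasure lam =
      ∫ x, ρ x * ‖bv x‖ ^ 2 * (u : EuclideanSpace ℝ (Fin 2) → ℝ) x ^ 2 ∂gaussLamMeasure lam :=
    integral_congr_ae (Eventually.of_forall fun x => by ring)
  have hAB : Integrable (fun x => ρ x * ‖(G : EuclideanSpace ℝ (Fin 2) → EuclideanSpace ℝ (Fin 2)) x‖ ^ 2 -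
      2 * (ρ x * (u : EuclideanSpace ℝ (Fin 2) → ℝ) x *
        ⟪(G : EuclideanSpace ℝ (Fin 2) → EuclideanSpace ℝ (Fin 2)) x, bv x⟫)) (gaussLamMeasure lam) :=
    hGG.sub (hGb.const_mul 2)
  rw [e1, e4, ← integral_const_mul, ← integral_sub hGG (hGb.const_mul 2), ← integral_add hAB huu]
  exact integral_congr_ae (Eventually.of_forall fun x => hexp x)

/-- `⟪u, (ρU)₁⟫ = ∫ ρ u² dμ_λ = ‖w‖²_{L²(dx)}`, `w = ρu`. [folklore] -/
theorem inner_fst_weightMul_fst_eq (u : Lp ℝ 2 (gaussLamMeasure lam)) :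
    ⟪u, (memLp_weight_mul_fst hlam u).toLp _⟫ =
      ∫ x, Real.exp (-((1 + lam) / 4 * x 0 ^ 2 + (1 - lam) / 4 * x 1 ^ 2)) *
        (u : EuclideanSpace ℝ (Fin 2) → ℝ) x ^ 2 ∂gaussLamMeasure lam := by
  rw [inner_weight_mul_fst_eq hlam]
  exact integral_congr_ae (Eventually.of_forall fun x => by ring)

/-- `0 ≤ ⟪u, (ρU)₁⟫`. [folklore] -/
theorem inner_fst_weightMul_fst_nonneg (u : Lp ℝ 2 (gaussLamMeasure lam)) :
    0 ≤ ⟪u, (memLp_weight_mul_fst hlam u).toLp _⟫ := by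
  rw [inner_fst_weightMul_fst_eq hlam]
  exact integral_nonneg fun x => by positivity

/-- `⟪u, (ρU)₁⟫ ≤ ‖u‖²` (`ρ ≤ 1`). [folklore] -/
theorem inner_fst_weightMul_fst_le (u : Lp ℝ 2 (gaussLamMeasure lam)) :
    ⟪u, (memLp_weight_mul_fst hlam u).toLp _⟫ ≤ ‖u‖ ^ 2 := by
  calc ⟪u, (memLp_weight_mul_fst hlam u).toLp _⟫ ≤ ‖u‖ * ‖(memLp_weight_mul_fst hlam u).toLp _‖ :=
        real_inner_le_norm _ _
    _ ≤ ‖u‖ * (1 * ‖u - 0‖) := by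
        refine mul_le_mul_of_nonneg_left ?_ (norm_nonneg _)
        have h := norm_weight_mul_fst_sub_le hlam u 0
        have h0 : (memLp_weight_mul_fst hlam (0 : Lp ℝ 2 (gaussLamMeasure lam))).toLp _ = 0 := by
          refine Lp.ext ?_
          filter_upwards [MemLp.coeFn_toLp (memLp_weight_mul_fst hlam (0 : Lp ℝ 2 (gaussLamMeasure lam))),
            Lp.coeFn_zero ℝ 2 (gaussLamMeasure lam)] with x hx h0
          rw [hx, h0, Pi.zero_apply, mul_zero]
        rwa [h0, sub_zero] at h
    _ = ‖u‖ ^ 2 := by rw [sub_zero, one_mul, sq]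

/-- **The flat energy identity**: for `U = (u, G) ∈ H¹(μ_λ)` with `ρU = ((ρU)₁, (ρU)₂)`,
`⟪G, (ρU)₂⟫_{L²(μ)} = ∫ ρ‖G − u b‖² dμ_λ − ½ ⟪u, (ρU)₁⟫`, i.e.
`⟨∇u, ∇^H(ρu)⟩_{L²(μ)} = ‖∇w‖²_{L²(dx)} − ½‖w‖²_{L²(dx)}` for `w = ρ u` — the weighted-space form of
`⟨−L_λ w, w⟩_{L²(dx)} = ‖∇w‖² − ½‖w‖²`. [folklore] -/
theorem inner_snd_weightMul_snd_eq
    {U : WithLp 2 (Lp ℝ 2 (gaussLamMeasure lam) × Lp (EuclideanSpace ℝ (Fin 2)) 2 (gaussLamMeasure lam))}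
    (hU : U ∈ gaussLamFormDomain lam) :
    ⟪U.snd, (memLp_weightMul_snd hlam U.fst U.snd).toLp _⟫ =
      (∫ x, Real.exp (-((1 + lam) / 4 * x 0 ^ 2 + (1 - lam) / 4 * x 1 ^ 2)) *
          ‖(U.snd : EuclideanSpace ℝ (Fin 2) → EuclideanSpace ℝ (Fin 2)) x -
            (U.fst : EuclideanSpace ℝ (Fin 2) → ℝ) x •
              (toLp 2 ![(1 + lam) / 2 * x 0, (1 - lam) / 2 * x 1] : EuclideanSpace ℝ (Fin 2))‖ ^ 2
          ∂gaussLamMeasure lam) -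
        1 / 2 * ⟪U.fst, (memLp_weight_mul_fst hlam U.fst).toLp _⟫ := by
  obtain ⟨-, hexp⟩ := integral_weight_mul_norm_sub_smul_sq_eq hlam U.fst U.snd
  have hibp := inner_snd_fst_smul_weight_drift_eq hlam hU
  have hsplit : (memLp_weightMul_snd hlam U.fst U.snd).toLp _ =
      (memLp_weight_smul_snd hlam U.snd).toLp _ - (memLp_fst_smul_weight_drift hlam U.fst).toLp _ :=
    MemLp.toLp_sub _ _
  rw [hsplit, inner_sub_right, hexp, hibp]
  ring

end Weight

end Literature.Analysis.FluidPDE
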